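import Literature.Analysis.FluidPDE.MildSolution
import Literature.Analysis.FluidPDE.VectorCalculus
import HarnessLib

/-!
# Crux `GaldiLiouvilleGate.ParabolicGaldiLiouville` (stmt-NavierStokesRegularity-0893), line
# `registered` (birth) — STUB 2b: the LPS quantity at `(9, 3)` from slice-wise Sobolev

Support file (`--supports stmt-NavierStokesRegularity-0893`) for the crux `ParabolicGaldiLiouville`
of the route `Summit.NavierStokesRegularity.NavierStokesRegularity.Theses.GaldiLiouvilleGate`
(parabolic Galdi–Liouville: a smooth bounded ancient mild Navier–Stokes solution on
`ℝ³ × (−∞, 0)` with bounded enstrophy and `L⁶` slices vanishes), birth line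
`Cruxes/ParabolicGaldiLiouville/Lines/birth.lean`, stub `stub_lpsOfSobolev`.

* `stub_lpsOfSobolev`: GIVEN the slice-wise Sobolev inequality
  `‖u‖_{L⁶} ≤ K (∫ |∇u|_F²)^{1/2}` for `C¹` fields `u ∈ L⁶(ℝ³; ℝ³)` (an explicit hypothesis; it
  is the sibling stub 2a of the line), a field `v` bounded on `(−∞, 0) × ℝ³`, smooth there, with
  `L⁶` slices and finite total dissipation `∫_{t<0} ∫ |∇v(t)|_F² < ∞` has a finite
  Ladyzhenskaya–Prodi–Serrin quantity at `(s, l) = (9, 3)`: `∫_{t<0} ‖v(t)‖_{L⁹}³ dt < ∞`.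

This is pure measure-theoretic bookkeeping (no Navier–Stokes content): for every `t < 0` the
slice `v t` is `C¹` (`LpsOfSobolev.contDiff_slice`); pointwise interpolation
`‖v t x‖⁹ ≤ M³ ‖v t x‖⁶` with `M = sup ‖v‖` gives
`‖v(t)‖₉³ = (∫ ‖v t‖⁹)^{1/3} ≤ M (∫ ‖v t‖⁶)^{1/3} = M ‖v(t)‖₆²`
(`LpsOfSobolev.eLpNorm_nine_pow_three_le`), the Sobolev hypothesis squares to
`‖v(t)‖₆² ≤ K² ∫ |∇v(t)|_F²`, and monotonicity of the (outer) Lebesgue integral in time plus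
`lintegral_const_mul'` bound the LPS quantity by `M K² ∫_{t<0} ∫ |∇v|_F² < ∞`. No measurability
of `t ↦ ‖v(t)‖₉` is needed (lower Lebesgue integrals are monotone unconditionally).

## References

* O. A. Ladyzhenskaya (1967), G. Prodi (1959), J. Serrin (1962): the `L^l_t L^s_x` classes with
  `3/s + 2/l = 1`; here `(s, l) = (9, 3)`.
* G. Seregin, *Lecture notes on regularity theory for the Navier–Stokes equations* (2014),
  Ch. 6, Thm 4.12 (the consumer of the LPS quantity in the line's composition).
-/

noncomputable section

-- the summit-side namespace `Summit.NavierStokesRegularity.NavierStokesRegularity.…` repeats a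
-- component by design (D-0017)
set_option linter.dupNamespace false

open Set Function MeasureTheory
open scoped NNReal ENNReal
open Literature.Analysis Literature.Analysis.FluidPDE

namespace Summit.NavierStokesRegularity.NavierStokesRegularity.Theorems

namespace ParabolicGaldiLiouville.Birth

namespace LpsOfSobolev

/-- Slices `v t`, `t < 0`, of a field smooth on `(−∞,0) × ℝ³` are `C¹`: compose
`uncurry v` with the smooth embedding `y ↦ (t, y)` and lower the order. [folklore] -/
theorem contDiff_slice {v : ℝ → EuclideanSpace ℝ (Fin 3) → EuclideanSpace ℝ (Fin 3)}
    (hsm : ContDiffOn ℝ (⊤ : ℕ∞) (uncurry v) (Iio 0 ×ˢ univ)) {t : ℝ} (ht : t < 0) :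
    ContDiff ℝ 1 (v t) := by
  have h : ContDiff ℝ (⊤ : ℕ∞) (uncurry v ∘ fun y : EuclideanSpace ℝ (Fin 3) => (t, y)) :=
    hsm.comp_contDiff (contDiff_const.prodMk contDiff_id) fun y => ⟨ht, mem_univ y⟩
  exact h.of_le (by exact_mod_cast le_top)

/-- Pointwise interpolation under a sup bound: if `‖f x‖ ≤ M` everywhere then
`∫⁻ ‖f‖ₑ⁹ ≤ (ofReal M)³ ∫⁻ ‖f‖ₑ⁶` (from `‖f x‖ₑ⁹ = ‖f x‖ₑ³ ‖f x‖ₑ⁶ ≤ (ofReal M)³ ‖f x‖ₑ⁶`;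
no measurability needed). [folklore] -/
theorem lintegral_pow_nine_le {f : EuclideanSpace ℝ (Fin 3) → EuclideanSpace ℝ (Fin 3)} {M : ℝ}
    (hf : ∀ x, ‖f x‖ ≤ M) :
    ∫⁻ x, ‖f x‖ₑ ^ (9 : ℕ) ≤ ENNReal.ofReal M ^ (3 : ℕ) * ∫⁻ x, ‖f x‖ₑ ^ (6 : ℕ) := by
  rw [← lintegral_const_mul' _ _ (ENNReal.pow_ne_top ENNReal.ofReal_ne_top)]
  refine lintegral_mono fun x => ?_
  have hx : ‖f x‖ₑ ≤ ENNReal.ofReal M := by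
    rw [← ofReal_norm]
    exact ENNReal.ofReal_le_ofReal (hf x)
  calc ‖f x‖ₑ ^ (9 : ℕ) = ‖f x‖ₑ ^ (3 : ℕ) * ‖f x‖ₑ ^ (6 : ℕ) := by rw [← pow_add]
    _ ≤ ENNReal.ofReal M ^ (3 : ℕ) * ‖f x‖ₑ ^ (6 : ℕ) := by gcongr

/-- The slice-wise LPS bound: if `‖f x‖ ≤ M` everywhere then
`‖f‖_{L⁹}³ ≤ (ofReal M) ‖f‖_{L⁶}²` (`‖f‖₉³ = (∫⁻ ‖f‖ₑ⁹)^{1/3} ≤ ((ofReal M)³ ∫⁻ ‖f‖ₑ⁶)^{1/3}`).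
[folklore] -/
theorem eLpNorm_nine_pow_three_le {f : EuclideanSpace ℝ (Fin 3) → EuclideanSpace ℝ (Fin 3)} {M : ℝ}
    (hf : ∀ x, ‖f x‖ ≤ M) :
    eLpNorm f 9 volume ^ (3 : ℕ) ≤ ENNReal.ofReal M * eLpNorm f 6 volume ^ (2 : ℕ) := by
  have h9 : eLpNorm f 9 volume ^ (3 : ℕ) = (∫⁻ x, ‖f x‖ₑ ^ (9 : ℕ)) ^ ((3 : ℝ)⁻¹) := by
    rw [eLpNorm_eq_lintegral_rpow_enorm_toReal (by norm_num) (by norm_num),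
      ← ENNReal.rpow_mul_natCast]
    norm_num
  have h6 : eLpNorm f 6 volume ^ (2 : ℕ) = (∫⁻ x, ‖f x‖ₑ ^ (6 : ℕ)) ^ ((3 : ℝ)⁻¹) := by
    rw [eLpNorm_eq_lintegral_rpow_enorm_toReal (by norm_num) (by norm_num),
      ← ENNReal.rpow_mul_natCast]
    norm_num
  rw [h9, h6]
  calc (∫⁻ x, ‖f x‖ₑ ^ (9 : ℕ)) ^ ((3 : ℝ)⁻¹)
      ≤ (ENNReal.ofReal M ^ (3 : ℕ) * ∫⁻ x, ‖f x‖ₑ ^ (6 : ℕ)) ^ ((3 : ℝ)⁻¹) := by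
        gcongr
        exact lintegral_pow_nine_le hf
    _ = ENNReal.ofReal M * (∫⁻ x, ‖f x‖ₑ ^ (6 : ℕ)) ^ ((3 : ℝ)⁻¹) := by
        rw [ENNReal.mul_rpow_of_nonneg _ _ (by norm_num)]
        congr 1
        exact_mod_cast ENNReal.pow_rpow_inv_natCast (n := 3) (by norm_num) (ENNReal.ofReal M)

end LpsOfSobolev

open LpsOfSobolev in
/-- **STUB 2b — `stub_lpsOfSobolev` (lead c1 reshaping of the birth stub 2 of the line
`Cruxes/ParabolicGaldiLiouville/Lines/birth.lean`).** GIVEN the slice-wise Sobolev inequality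
`‖u‖_{L⁶} ≤ K (∫ |∇u|_F²)^{1/2}` for `C¹` fields `u ∈ L⁶(ℝ³; ℝ³)` (explicit hypothesis = the
sibling stub 2a), a field `v` bounded on `(−∞,0) × ℝ³`, smooth there, with `L⁶` slices and finite
total dissipation has a finite Ladyzhenskaya–Prodi–Serrin quantity at `(s, l) = (9, 3)`:
`∫_{t<0} ‖v(t)‖_{L⁹}³ dt < ∞`. Proof: slices are `C¹` (`contDiff_slice`); for each `t < 0`,
`‖v(t)‖₉³ ≤ ‖v‖_∞ ‖v(t)‖₆² ≤ ‖v‖_∞ K² ∫ |∇v(t)|_F²` (`eLpNorm_nine_pow_three_le` and the squared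
hypothesis); monotonicity of the time integral and `lintegral_const_mul'`. [folklore] -/
theorem stub_lpsOfSobolev :
    (∃ K : NNReal, ∀ u : EuclideanSpace ℝ (Fin 3) → EuclideanSpace ℝ (Fin 3),
      ContDiff ℝ 1 u → MeasureTheory.MemLp u 6 MeasureTheory.volume →
      MeasureTheory.eLpNorm u 6 MeasureTheory.volume ≤
        (K : ENNReal) * (∫⁻ y, ENNReal.ofReal
          (Literature.Analysis.FluidPDE.frobeniusNormSq (fderiv ℝ u y))) ^ (1 / 2 : ℝ)) →
    ∀ v : ℝ → EuclideanSpace ℝ (Fin 3) → EuclideanSpace ℝ (Fin 3),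
      Literature.Analysis.FluidPDE.IsBoundedOn (Set.Iio 0) v →
      ContDiffOn ℝ (⊤ : ℕ∞) (Function.uncurry v) (Set.Iio 0 ×ˢ Set.univ) →
      (∀ s < 0, MeasureTheory.MemLp (v s) 6 MeasureTheory.volume) →
      (∫⁻ s in Set.Iio 0, ∫⁻ y, ENNReal.ofReal
          (Literature.Analysis.FluidPDE.frobeniusNormSq (fderiv ℝ (v s) y))) < ⊤ →
      (∫⁻ t in Set.Iio 0,
          (MeasureTheory.eLpNorm (v t) (ENNReal.ofReal 9) MeasureTheory.volume) ^ (3 : ℝ)) < ⊤ := by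
  intro hSob v hb hsm hL6 hdiss
  obtain ⟨K, hK⟩ := hSob
  obtain ⟨C, hC⟩ := hb
  -- the slice-wise bound `‖v(t)‖₉³ ≤ (ofReal C · K²) ∫ |∇v(t)|_F²` for every `t < 0`
  have hslice : ∀ t ∈ Iio (0 : ℝ),
      eLpNorm (v t) (ENNReal.ofReal 9) volume ^ (3 : ℝ) ≤
        (ENNReal.ofReal C * (K : ℝ≥0∞) ^ (2 : ℕ)) *
          ∫⁻ y, ENNReal.ofReal (frobeniusNormSq (fderiv ℝ (v t) y)) := by
    intro t ht
    have h6 : eLpNorm (v t) 6 volume ^ (2 : ℕ) ≤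
        (K : ℝ≥0∞) ^ (2 : ℕ) * ∫⁻ y, ENNReal.ofReal (frobeniusNormSq (fderiv ℝ (v t) y)) := by
      calc eLpNorm (v t) 6 volume ^ (2 : ℕ)
          ≤ ((K : ℝ≥0∞) * (∫⁻ y, ENNReal.ofReal
              (frobeniusNormSq (fderiv ℝ (v t) y))) ^ (1 / 2 : ℝ)) ^ (2 : ℕ) := by
            gcongr
            exact hK (v t) (contDiff_slice hsm ht) (hL6 t ht)
        _ = (K : ℝ≥0∞) ^ (2 : ℕ) *
              ∫⁻ y, ENNReal.ofReal (frobeniusNormSq (fderiv ℝ (v t) y)) := by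
            rw [mul_pow, ← ENNReal.rpow_mul_natCast]
            norm_num
    rw [ENNReal.ofReal_ofNat, ENNReal.rpow_ofNat]
    calc eLpNorm (v t) 9 volume ^ (3 : ℕ)
        ≤ ENNReal.ofReal C * eLpNorm (v t) 6 volume ^ (2 : ℕ) :=
          eLpNorm_nine_pow_three_le fun x => hC t ht x
      _ ≤ ENNReal.ofReal C * ((K : ℝ≥0∞) ^ (2 : ℕ) *
            ∫⁻ y, ENNReal.ofReal (frobeniusNormSq (fderiv ℝ (v t) y))) := by gcongr
      _ = (ENNReal.ofReal C * (K : ℝ≥0∞) ^ (2 : ℕ)) *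
            ∫⁻ y, ENNReal.ofReal (frobeniusNormSq (fderiv ℝ (v t) y)) := (mul_assoc _ _ _).symm
  have hc : ENNReal.ofReal C * (K : ℝ≥0∞) ^ (2 : ℕ) ≠ ⊤ :=
    ENNReal.mul_ne_top ENNReal.ofReal_ne_top (ENNReal.pow_ne_top ENNReal.coe_ne_top)
  calc ∫⁻ t in Iio 0, eLpNorm (v t) (ENNReal.ofReal 9) volume ^ (3 : ℝ)
      ≤ ∫⁻ t in Iio 0, (ENNReal.ofReal C * (K : ℝ≥0∞) ^ (2 : ℕ)) *
          ∫⁻ y, ENNReal.ofReal (frobeniusNormSq (fderiv ℝ (v t) y)) :=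
        setLIntegral_mono' measurableSet_Iio hslice
    _ = (ENNReal.ofReal C * (K : ℝ≥0∞) ^ (2 : ℕ)) *
          ∫⁻ t in Iio 0, ∫⁻ y, ENNReal.ofReal (frobeniusNormSq (fderiv ℝ (v t) y)) :=
        lintegral_const_mul' _ _ hc
    _ < ⊤ := ENNReal.mul_lt_top hc.lt_top hdiss

end ParabolicGaldiLiouville.Birth

end Summit.NavierStokesRegularity.NavierStokesRegularity.Theorems
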